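import Summits.BirchSwinnertonDyer.BirchSwinnertonDyer.Theorems.ByReductionTypeAtTwoTowerNoFiniteSubmoduleOfCasselsTatePackage
import Summits.BirchSwinnertonDyer.BirchSwinnertonDyer.Theorems.ThetaPartnerAtTwoSignedControlAtTwoPlusKimSignedUnion
import Summits.BirchSwinnertonDyer.BirchSwinnertonDyer.Theorems.ThetaPartnerAtTwoSignedTransportAtTwoResidualKummer
import Summits.BirchSwinnertonDyer.BirchSwinnertonDyer.Theorems.ByReductionTypeAtTwoMultTransportSelmer
import Literature.NumberTheory.EllipticCurves.Kobayashi2003.SignedSelmerModuleFiniteProofs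
import HarnessLib

/-!
# DIV⁺@2 at EVERY rank (the second input of item 23110; K1's `stub_plusDiv2`) on the HACHIMORI–MATSUNO road: Kobayashi's
# `X^ε(E/K_∞)` has no non-zero finite `Λ`-submodule, given ONLY the Cassels–Tate–Flach layer pairings on `Sel^ε(E/K_n)` —
# every number field, prime, `ℤ_p`-extension, sign; stabilisation, kernels, layers, `Γ`-action DISCHARGED

Routes `ResidualThetaTransportAtTwo` (RTT, crux r201 `ResidualLambdaFormulaNegDiscAtTwo`, stmt-BirchSwinnertonDyer-23110) /
`ThetaPartnerAtTwo` (K1 `SignedTransportAtTwo`, line `bridge`, registered stub `stub_plusDiv2`). Seat `prover-bsd-rtt-w4` (width w4 of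
keying brief (195)); `--supports stmt-BirchSwinnertonDyer-23110`. THEOREMS ONLY (no definition, no named fact, no `sorry`).

WHY. At every rank 23110 = SURJ⁺@2 ∧ DIV⁺@2 (`ResidualThetaLayer.residualLambdaFormulaNegDiscAtTwo_of_surj2_of_plusDiv2`, p644772).
The printed all-rank proofs of DIV⁺ (= «`X⁺` has no non-zero finite `Λ`-submodule» for `X⁺` torsion, μ = 0) twist by `κ^s`
(Greenberg LNM 1716 Prop. 4.14, B. D. Kim 2013, Ponsinet 2020) — the tree has no twist object. Hachimori–Matsuno (Proc. AMS 128
(2000)) prove Greenberg's Prop. 4.14 WITHOUT twists, from the Cassels–Tate pairings on the layers `Sel(E/K_n)/div`; the tree runs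
their argument in the kernel for the PLAIN Selmer tower (`TowerHaMa.SelmerDualData.forall_finite_eq_bot_of_casselsTatePackage`, cell
`bsd-2adic`, over the abstract engine `Rank1Residual.Iwasawa.forall_finite_eq_bot_of_selfDualLayers_of_isTorsion`, cell `bsd-potss`).
Kobayashi's signed local condition is SELF-DUAL under local Tate duality (B. D. Kim, J. Number Theory 129 (2009), the generalised
Cassels–Tate pairing on `Sel^±(E/K_n)/div` after Flach 1990 — printed for odd `p`), so the same road serves `Sel^ε`. THIS FILE runs it
VERBATIM on Kobayashi's signed tower `Sel^ε(E/K_n) = signedSelmerLayer W κ ε n →(layerToInfty)→ signedSelmerInfty W κ ε`: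

* §1 `SignedSelmerDualData.forall_finite_eq_bot_of_casselsTatePackage` — ANY number field `K`, elliptic `W/K` with `E(K)[p] = 0`,
  ANY `ℤ_p`-extension `κ` with topological generator `γ`, ANY sign `ε`, ANY datum `D : SignedSelmerDualData W κ γ ε` with `D.X` finitely
  generated `Λ`-torsion: if the layers `Sel^ε(E/K_n)` carry biadditive skew-symmetric `conj_γ`-invariant pairings with `p`-divisible
  right kernel and every character vanishing on the right kernel represented, plus corestrictions realising the norm after
  restriction to `K_∞` and adjoint to `res_{K_{n+1}/K_n}` (DISPLAYED; = the Cassels–Tate–Flach package), then `D.X` has no non-zero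
  finite `Λ`-submodule. Supplied in the kernel: injective layers (`TowerHaMa.layerToInfty_injective_of_no_pTorsion`), transitions
  (`SignedEC.resOfLe_mem_signedSelmerLayer`), exhaustion (`SignedEC.mem_signedSelmerInfty_iff_exists_layer`), `Γ`-action
  (`conjH1_mem_signedSelmerLayer`), right kernels and their stability, STABILISATION from `Λ`-torsion (`…_of_isTorsion`,
  `SignedSelmerDualData.isDualPair`).
* §2 `signedSelmerInfty_divisible_of_casselsTatePackage` — … and `μ = 0` ⟹ `Sel^ε(E/K_∞)` is `p`-divisible
  (`MultTransportAtTwo.divisible_of_noFiniteSubmodule`); `plusDiv2_of_casselsTatePackage` — `K = ℚ`, `p = 2`, `ε = +`, `E` good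
  supersingular at `2` (`E(ℚ)[2] = 0` by `SignedTransportAtTwo.eq_zero_of_two_nsmul_eq_zero_of_goodSS`): the conclusion of
  `stub_plusDiv2` for ONE curve of ANY rank, conditional only on the displayed signed Cassels–Tate package at `2`.

HONEST FRAMING: CONDITIONAL on the displayed package (Kim 2009 / Flach 1990 READ AT `2` — unprinted at `2`); closes nothing; BSD is
not proved by any of this.
References: [HachimoriMatsuno2000] Theorem, Cor. (i), proof p. 2540 L28–L45; [GreenbergLNM1716] §4 Prop. 4.14; [BDKim2013] Thm. 1.1;
[Kobayashi2003] Def. 1.1; [MilneADT2006] I Prop. 6.9, Thm. 6.13, Rem. 6.10; [Flach1990] (generalised Cassels–Tate pairing).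
-/

set_option autoImplicit false
-- D-0017: single-problem summit, so `Summit.BirchSwinnertonDyer.BirchSwinnertonDyer.…` repeats a namespace BY DESIGN.
set_option linter.dupNamespace false

noncomputable section

open scoped Classical

universe u

namespace Summit.BirchSwinnertonDyer.BirchSwinnertonDyer.Theorems.ResidualThetaLayer.SignedTowerHaMa

open NumberField IsDedekindDomain Field WeierstrassCurve Literature.NumberTheory.EllipticCurves
  Literature.NumberTheory.EllipticCurves.ZpExtension Literature.NumberTheory.GaloisRepresentations
  Literature.NumberTheory.EllipticCurves.Kobayashi2003
  Summit.BirchSwinnertonDyer.Rank1Residual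
  Summit.BirchSwinnertonDyer.BirchSwinnertonDyer.Theorems.TowerHaMa

/-! ## §1 Kobayashi's signed tower, torsion dual datum: only the Cassels–Tate–Flach layer pairings displayed -/

section Tower

variable {K : Type u} [Field K] [NumberField K] (W : WeierstrassCurve K) [W.IsElliptic] {p : ℕ} [Fact p.Prime]
  (κ : ZpExtension K p) (ε : ℤˣ) {γ : Field.absoluteGaloisGroup K}

/-- **Hachimori–Matsuno on Kobayashi's signed Selmer tower — only the Cassels–Tate–Flach layer pairings displayed.** For ANY
number field `K`, elliptic `W/K` with `E(K)[p] = 0` (`hK`), ANY `ℤ_p`-extension `κ` with topological generator `γ`, ANY sign `ε`, ANY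
dual datum `D : SignedSelmerDualData W κ γ ε` with `D.X` finitely generated and `Λ`-torsion: if the layers `Sel^ε(E/K_n)`
(`signedSelmerLayer W κ ε n`) carry biadditive pairings `⟨·,·⟩_n` which are skew-symmetric (`hskew`), `conj_γ`-invariant (`hinv`), with
`p`-divisible right kernel (`hdiv`) and every character vanishing on the right kernel represented (`hsurj`), together with
corestrictions `Sel^ε(E/K_{n+1}) → Sel^ε(E/K_n)` realising the norm `Σ_{i<p} conj_{γ^{pⁿ i}}` after restriction to `K_∞` and adjoint to
`res_{K_{n+1}/K_n}` (`hcores`), all pinned to the tree's maps `layerToInfty`, `resOfLe`, `conjH1` by their values — then `D.X` has no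
non-zero finite `Λ`-submodule (B. D. Kim's Thm. 1.1 shape, for every `p`, in particular `p = 2`). The proof of
`TowerHaMa.SelmerDualData.forall_finite_eq_bot_of_casselsTatePackage` VERBATIM on the signed objects.
[cite: HachimoriMatsuno2000, Theorem and Corollary (i), proof p. 2540 L28–L45] [cite: BDKim2013, Thm. 1.1]
[cite: MilneADT2006, I Prop. 6.9, Thm. 6.13 (a)(b), Rem. 6.10] [cite: Kobayashi2003, Def. 1.1] -/
theorem SignedSelmerDualData.forall_finite_eq_bot_of_casselsTatePackage (hγ : κ.IsTopGenerator γ)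
    (hK : ∀ P : W.toAffine.Point, p • P = 0 → P = 0) (D : SignedSelmerDualData W κ γ ε)
    [Module.Finite (IwasawaAlgebra p) D.X] (htor : Module.IsTorsion (IwasawaAlgebra p) D.X)
    (pair : ∀ n, signedSelmerLayer W κ ε n →+ signedSelmerLayer W κ ε n →+ AddCircle (1 : ℚ))
    (hskew : ∀ n (y t : signedSelmerLayer W κ ε n), pair n y t = -pair n t y)
    (hinv : ∀ n (y t y' t' : signedSelmerLayer W κ ε n),
      (y' : W.subgroupH1 p (κ.layerSubgroup n)) = W.conjH1 p (κ.layerSubgroup n) γ y →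
      (t' : W.subgroupH1 p (κ.layerSubgroup n)) = W.conjH1 p (κ.layerSubgroup n) γ t → pair n y' t' = pair n y t)
    (hdiv : ∀ n (t : signedSelmerLayer W κ ε n), (∀ y, pair n y t = 0) →
      ∃ t' : signedSelmerLayer W κ ε n, (∀ y, pair n y t' = 0) ∧ p • t' = t)
    (hsurj : ∀ n (g : signedSelmerLayer W κ ε n →+ AddCircle (1 : ℚ)),
      (∀ t, (∀ y, pair n y t = 0) → g t = 0) → ∃ c, ∀ y, g y = pair n y c)
    (hcores : ∀ n (t : signedSelmerLayer W κ ε (n + 1)), ∃ t' : signedSelmerLayer W κ ε n,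
      W.layerToInfty κ n t' =
        ∑ i ∈ Finset.range p, W.conjH1 p κ.kerSubgroup (γ ^ (p ^ n * i)) (W.layerToInfty κ (n + 1) t) ∧
      ∀ (y : signedSelmerLayer W κ ε n) (y' : signedSelmerLayer W κ ε (n + 1)),
        (y' : W.subgroupH1 p (κ.layerSubgroup (n + 1))) =
          W.resOfLe p (κ.layerSubgroup_antitone (Nat.le_succ n)) y → pair n y t' = pair (n + 1) y' t) :
    ∀ M : Submodule (IwasawaAlgebra p) D.X, Finite M → M = ⊥ := by
  -- the tree's signed layer data as additive maps
  let r : ∀ n, signedSelmerLayer W κ ε n →+ signedSelmerInfty W κ ε := fun n ↦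
    ((W.layerToInfty κ n).comp (signedSelmerLayer W κ ε n).subtype).codRestrict (signedSelmerInfty W κ ε)
      fun x ↦ map_layerToInfty_signedSelmerLayer_le W κ ε n ⟨x, x.2, rfl⟩
  have hr_coe : ∀ n (x : signedSelmerLayer W κ ε n),
      ((r n x : signedSelmerInfty W κ ε) : W.subgroupH1 p κ.kerSubgroup) = W.layerToInfty κ n x := fun _ _ ↦ rfl
  let ι : ∀ n, signedSelmerLayer W κ ε n →+ signedSelmerLayer W κ ε (n + 1) := fun n ↦
    ((W.resOfLe p (κ.layerSubgroup_antitone (Nat.le_succ n))).comp (signedSelmerLayer W κ ε n).subtype).codRestrict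
      (signedSelmerLayer W κ ε (n + 1)) fun x ↦ SignedEC.resOfLe_mem_signedSelmerLayer W κ ε (Nat.le_succ n) x.2
  have hι_coe : ∀ n (x : signedSelmerLayer W κ ε n),
      ((ι n x : signedSelmerLayer W κ ε (n + 1)) : W.subgroupH1 p (κ.layerSubgroup (n + 1))) =
        W.resOfLe p (κ.layerSubgroup_antitone (Nat.le_succ n)) x := fun _ _ ↦ rfl
  let γL : ∀ n, signedSelmerLayer W κ ε n →+ signedSelmerLayer W κ ε n := fun n ↦
    ((W.conjH1 p (κ.layerSubgroup n) γ).comp (signedSelmerLayer W κ ε n).subtype).codRestrict (signedSelmerLayer W κ ε n)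
      fun x ↦ conjH1_mem_signedSelmerLayer W κ ε n γ x.2
  have hγL_coe : ∀ n (x : signedSelmerLayer W κ ε n),
      ((γL n x : signedSelmerLayer W κ ε n) : W.subgroupH1 p (κ.layerSubgroup n)) =
        W.conjH1 p (κ.layerSubgroup n) γ x := fun _ _ ↦ rfl
  -- the right kernels of the displayed pairings
  let Dn : ∀ n, AddSubgroup (signedSelmerLayer W κ ε n) := fun n ↦
    { carrier := {t | ∀ y, pair n y t = 0}
      zero_mem' := fun y ↦ map_zero _
      add_mem' := fun {a b} ha hb y ↦ by rw [map_add, ha y, hb y, add_zero]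
      neg_mem' := fun {a} ha y ↦ by rw [map_neg, ha y, neg_zero] }
  have hDn : ∀ n (t : signedSelmerLayer W κ ε n), t ∈ Dn n ↔ ∀ y, pair n y t = 0 := fun _ _ ↦ Iff.rfl
  -- (a) injective layers (`E(K)[p] = 0`)
  have hr : ∀ n, Function.Injective (r n) := fun n x y h ↦
    Subtype.ext (layerToInfty_injective_of_no_pTorsion W κ hγ hK n (by rw [← hr_coe, ← hr_coe, h]))
  -- transitions over `Sel^ε_∞`
  have hι : ∀ n (x : signedSelmerLayer W κ ε n), r (n + 1) (ι n x) = r n x := fun n x ↦ by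
    apply Subtype.ext
    rw [hr_coe, hr_coe, hι_coe]
    exact congrArg (fun f ↦ f (x : W.subgroupH1 p (κ.layerSubgroup n)))
      (W.resOfLe_comp_holds p (κ.kerSubgroup_le_layerSubgroup (n + 1)) (κ.layerSubgroup_antitone (Nat.le_succ n)))
  -- exhaustion
  have hex : ∀ s : signedSelmerInfty W κ ε, ∃ n, ∃ x : signedSelmerLayer W κ ε n, r n x = s := fun s ↦ by
    obtain ⟨n, y, hy, hys⟩ := (SignedEC.mem_signedSelmerInfty_iff_exists_layer W κ ε
      (s : W.subgroupH1 p κ.kerSubgroup)).mp s.2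
    exact ⟨n, ⟨y, hy⟩, Subtype.ext hys⟩
  -- the `Γ`-action on the layers over `conj_γ`
  have hγL : ∀ n (x : signedSelmerLayer W κ ε n), r n (γL n x) = conjSignedSelmerInfty W κ ε γ (r n x) := fun n x ↦ by
    apply Subtype.ext
    rw [hr_coe, coe_conjSignedSelmerInfty_apply, hr_coe, hγL_coe]
    exact congrArg (fun f ↦ f (x : W.subgroupH1 p (κ.layerSubgroup n)))
      (resOfLe_comp_conjH1_holds (M := geomPrimaryTorsion W p) (κ.kerSubgroup_le_layerSubgroup n) γ)
  have hγLs : ∀ n, Function.Surjective (γL n) := fun n y ↦ by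
    refine ⟨⟨W.conjH1 p (κ.layerSubgroup n) γ⁻¹ y, conjH1_mem_signedSelmerLayer W κ ε n γ⁻¹ y.2⟩, Subtype.ext ?_⟩
    rw [hγL_coe]
    change ((W.conjH1 p (κ.layerSubgroup n) γ).comp (W.conjH1 p (κ.layerSubgroup n) γ⁻¹)) _ = _
    rw [← W.conjH1_mul_holds p (κ.layerSubgroup n) γ γ⁻¹, mul_inv_cancel, W.conjH1_one_holds p (κ.layerSubgroup n),
      AddMonoidHom.id_apply]
  -- the displayed package, transported to the abstract shape
  have hinv' : ∀ n (y t : signedSelmerLayer W κ ε n), pair n (γL n y) (γL n t) = pair n y t :=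
    fun n y t ↦ hinv n y t (γL n y) (γL n t) (hγL_coe n y) (hγL_coe n t)
  have hcores' : ∀ n (t : signedSelmerLayer W κ ε (n + 1)), ∃ t' : signedSelmerLayer W κ ε n,
      r n t' = ∑ i ∈ Finset.range p, ((conjSignedSelmerInfty W κ ε γ) ^ (p ^ n * i)) (r (n + 1) t) ∧
      ∀ y : signedSelmerLayer W κ ε n, pair n y t' = pair (n + 1) (ι n y) t := fun n t ↦ by
    obtain ⟨t', ht', hadj⟩ := hcores n t
    refine ⟨t', Subtype.ext ?_, fun y ↦ hadj y (ι n y) (hι_coe n y)⟩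
    rw [hr_coe, ht', AddSubmonoidClass.coe_finsetSum]
    exact Finset.sum_congr rfl fun i _ ↦ (coe_conjSignedSelmerInfty_pow_apply W κ ε γ (p ^ n * i) (r (n + 1) t)).symm
  -- the right kernels: `p`-divisible, `conj_γ`-stable, restriction-compatible, exact, characters represented
  have hDdiv : ∀ n, ∀ d ∈ Dn n, ∃ d' ∈ Dn n, p • d' = d := fun n d hd ↦ by
    obtain ⟨d', hd', h⟩ := hdiv n d ((hDn n d).mp hd)
    exact ⟨d', (hDn n d').mpr hd', h⟩
  have hDγ : ∀ n, ∀ d ∈ Dn n, γL n d ∈ Dn n := fun n d hd ↦ by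
    rw [hDn] at hd ⊢
    intro y
    obtain ⟨y₀, rfl⟩ := hγLs n y
    rw [hinv', hd y₀]
  have hDι : ∀ n, ∀ d ∈ Dn n, ι n d ∈ Dn (n + 1) := fun n d hd ↦ by
    rw [hDn] at hd ⊢
    intro y'
    obtain ⟨c, _, hadj⟩ := hcores' n y'
    rw [hskew (n + 1), ← hadj d, hskew n, hd c, neg_zero, neg_zero]
  have hker : ∀ n (t : signedSelmerLayer W κ ε n), (∀ y, pair n y t = 0) → t ∈ Dn n := fun n t ht ↦ (hDn n t).mpr ht
  have hD0 : ∀ n, ∀ t ∈ Dn n, ∀ y, pair n y t = 0 := fun n t ht ↦ (hDn n t).mp ht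
  have hsurj' : ∀ n (g : signedSelmerLayer W κ ε n →+ AddCircle (1 : ℚ)), (∀ d ∈ Dn n, g d = 0) →
      ∃ c, ∀ y, g y = pair n y c := fun n g hg ↦ hsurj n g fun t ht ↦ hg t ((hDn n t).mpr ht)
  -- Hachimori–Matsuno WITHOUT stabilisation hypothesis (cell `bsd-potss`, `DivisiblePartsStationary`)
  exact Iwasawa.forall_finite_eq_bot_of_selfDualLayers_of_isTorsion p (conjSignedSelmerInfty W κ ε γ) r ι γL Dn pair D.toDual
    (D.isDualPair hγ) htor hr hι hex hγL hγLs hcores' hDdiv hDγ hDι hker hD0 hsurj' hinv'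

/-! ## §2 Divisibility of `Sel^ε(E/K_∞)`; DIV⁺@2 for one curve of any rank -/

/-- **`Sel^ε(E/K_∞)` is `p`-divisible from the signed Cassels–Tate package**, for `D.X` finitely generated `Λ`-torsion with
`μ = 0` and `E(K)[p] = 0`: §1 gives no non-zero finite `Λ`-submodule, and `MultTransportAtTwo.divisible_of_noFiniteSubmodule`
(`X[p]` finite ⇒ `0`; characters separate `Sel/p`) gives divisibility. [cite: HachimoriMatsuno2000, Theorem and Corollary (i)]
[cite: BDKim2013, Thm. 1.1] [cite: GreenbergLNM1716, §4 Props. 4.14–4.15] -/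
theorem signedSelmerInfty_divisible_of_casselsTatePackage (hγ : κ.IsTopGenerator γ)
    (hK : ∀ P : W.toAffine.Point, p • P = 0 → P = 0) (D : SignedSelmerDualData W κ γ ε)
    [Module.Finite (IwasawaAlgebra p) D.X] (htor : Module.IsTorsion (IwasawaAlgebra p) D.X) (hμ : D.mu = 0)
    (pair : ∀ n, signedSelmerLayer W κ ε n →+ signedSelmerLayer W κ ε n →+ AddCircle (1 : ℚ))
    (hskew : ∀ n (y t : signedSelmerLayer W κ ε n), pair n y t = -pair n t y)
    (hinv : ∀ n (y t y' t' : signedSelmerLayer W κ ε n),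
      (y' : W.subgroupH1 p (κ.layerSubgroup n)) = W.conjH1 p (κ.layerSubgroup n) γ y →
      (t' : W.subgroupH1 p (κ.layerSubgroup n)) = W.conjH1 p (κ.layerSubgroup n) γ t → pair n y' t' = pair n y t)
    (hdiv : ∀ n (t : signedSelmerLayer W κ ε n), (∀ y, pair n y t = 0) →
      ∃ t' : signedSelmerLayer W κ ε n, (∀ y, pair n y t' = 0) ∧ p • t' = t)
    (hsurj : ∀ n (g : signedSelmerLayer W κ ε n →+ AddCircle (1 : ℚ)),
      (∀ t, (∀ y, pair n y t = 0) → g t = 0) → ∃ c, ∀ y, g y = pair n y c)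
    (hcores : ∀ n (t : signedSelmerLayer W κ ε (n + 1)), ∃ t' : signedSelmerLayer W κ ε n,
      W.layerToInfty κ n t' =
        ∑ i ∈ Finset.range p, W.conjH1 p κ.kerSubgroup (γ ^ (p ^ n * i)) (W.layerToInfty κ (n + 1) t) ∧
      ∀ (y : signedSelmerLayer W κ ε n) (y' : signedSelmerLayer W κ ε (n + 1)),
        (y' : W.subgroupH1 p (κ.layerSubgroup (n + 1))) =
          W.resOfLe p (κ.layerSubgroup_antitone (Nat.le_succ n)) y → pair n y t' = pair (n + 1) y' t) :
    ∀ s ∈ signedSelmerInfty W κ ε, ∃ s' ∈ signedSelmerInfty W κ ε, p • s' = s := by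
  have hF := SignedSelmerDualData.forall_finite_eq_bot_of_casselsTatePackage W κ ε hγ hK D htor pair hskew hinv hdiv hsurj hcores
  have hd := MultTransportAtTwo.divisible_of_noFiniteSubmodule p D.X htor hμ hF (AddEquiv.ofBijective D.toDual D.bijective)
  intro s hs
  obtain ⟨t, ht⟩ := hd ⟨s, hs⟩
  exact ⟨t, t.2, by simpa using congrArg Subtype.val ht⟩

end Tower

/-- **DIV⁺@2 for ONE curve of ANY rank from the signed Cassels–Tate package at `2`** (`K = ℚ`, `p = 2`, `ε = +`): for `E/ℚ`
globally minimal with good supersingular reduction at `2` (`E(ℚ)[2] = 0`, `SignedTransportAtTwo.eq_zero_of_two_nsmul_eq_zero_of_goodSS`),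
any `ℤ₂`-extension `κ` with topological generator `γ`, and a `+` dual datum with `X⁺` finitely generated `Λ`-torsion and `μ = 0`:
granted the Cassels–Tate–Flach pairings on the layers `Sel⁺(E/ℚ_n)` (displayed), `Sel⁺(E/ℚ_∞)` is `2`-divisible — the conclusion of
the registered stub `stub_plusDiv2` for this curve, i.e. the second input of `ResidualThetaLayer.rlf2_of_surj_of_plusDiv`.
[cite: HachimoriMatsuno2000, Theorem and Corollary (i)] [cite: BDKim2013, Thm. 1.1] [cite: Kobayashi2003, Def. 1.1] -/
theorem plusDiv2_of_casselsTatePackage {E : WeierstrassCurve ℚ} [E.IsElliptic] [E.IsGloballyMinimal]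
    (hss : Literature.NumberTheory.EllipticCurves.Rank1Residual.GoodSS E 2) (κ : ZpExtension ℚ 2) {γ : Field.absoluteGaloisGroup ℚ} (hγ : κ.IsTopGenerator γ)
    (D : SignedSelmerDualData E κ γ 1) [Module.Finite (IwasawaAlgebra 2) D.X]
    (htor : Module.IsTorsion (IwasawaAlgebra 2) D.X) (hμ : D.mu = 0)
    (pair : ∀ n, signedSelmerLayer E κ 1 n →+ signedSelmerLayer E κ 1 n →+ AddCircle (1 : ℚ))
    (hskew : ∀ n (y t : signedSelmerLayer E κ 1 n), pair n y t = -pair n t y)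
    (hinv : ∀ n (y t y' t' : signedSelmerLayer E κ 1 n),
      (y' : E.subgroupH1 2 (κ.layerSubgroup n)) = E.conjH1 2 (κ.layerSubgroup n) γ y →
      (t' : E.subgroupH1 2 (κ.layerSubgroup n)) = E.conjH1 2 (κ.layerSubgroup n) γ t → pair n y' t' = pair n y t)
    (hdiv : ∀ n (t : signedSelmerLayer E κ 1 n), (∀ y, pair n y t = 0) →
      ∃ t' : signedSelmerLayer E κ 1 n, (∀ y, pair n y t' = 0) ∧ 2 • t' = t)
    (hsurj : ∀ n (g : signedSelmerLayer E κ 1 n →+ AddCircle (1 : ℚ)),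
      (∀ t, (∀ y, pair n y t = 0) → g t = 0) → ∃ c, ∀ y, g y = pair n y c)
    (hcores : ∀ n (t : signedSelmerLayer E κ 1 (n + 1)), ∃ t' : signedSelmerLayer E κ 1 n,
      E.layerToInfty κ n t' =
        ∑ i ∈ Finset.range 2, E.conjH1 2 κ.kerSubgroup (γ ^ (2 ^ n * i)) (E.layerToInfty κ (n + 1) t) ∧
      ∀ (y : signedSelmerLayer E κ 1 n) (y' : signedSelmerLayer E κ 1 (n + 1)),
        (y' : E.subgroupH1 2 (κ.layerSubgroup (n + 1))) =
          E.resOfLe 2 (κ.layerSubgroup_antitone (Nat.le_succ n)) y → pair n y t' = pair (n + 1) y' t) :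
    ∀ s ∈ signedSelmerInfty E κ 1, ∃ s' ∈ signedSelmerInfty E κ 1, 2 • s' = s :=
  signedSelmerInfty_divisible_of_casselsTatePackage (p := 2) E κ 1 hγ
    (fun P hP ↦ SignedTransportAtTwo.eq_zero_of_two_nsmul_eq_zero_of_goodSS E hss P (by convert hP)) D htor hμ pair hskew
      hinv hdiv
    hsurj hcores

end Summit.BirchSwinnertonDyer.BirchSwinnertonDyer.Theorems.ResidualThetaLayer.SignedTowerHaMa

end
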